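import Summits.KontsevichZagierPeriods.KontsevichZagierPeriods.Theorems.GpcZeta4Eq4zeta31.Negative.InvScissors
import Summits.KontsevichZagierPeriods.KontsevichZagierPeriods.Theorems.GpcZeta4Eq4zeta31.Negative.Gap

/-!
# `GpcZeta4Eq4zeta31` (stmt-KontsevichZagierPeriods-0275): negative side — no spectator variable
# (slab invariants, the first constraint on chains WITH Newton–Leibniz moves)

Companion of `InvScissors.lean` (cdisprove unit of the crux `GpcZeta4Eq4zeta31`, route `Grothendieck`).
For a coordinate index `k` and a rational half-line `S`, the SLAB evaluation `[σ, f] ↦ ∫_{σ ∩ {x_k ∈ S}} f`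
(empty in dimensions `≤ k`) is additive, invariant under changes of variables preserving the slab, AND
invariant under every Newton–Leibniz move whose base has dimension `≠ k` — i.e. under all NL moves except
those integrating out the coordinate of index `k` (`windowEval_slab_eq_zero_of_nl`: restrict the move to
the part of the band over `τ ∩ {x_k ∈ S}`, again a legal NL move because `x_k` is a base coordinate, and
use soundness). So it kills the SLAB CALCULUS `slabCalculus k S = closure (domainAdd ∪ integrandAdd ∪
invCovRel (slab k S) ∪ nlRelExcept k)`. On the target: `∫_{Δ₄ ∩ {t_k < 1/5}} (ω₀₀₀₁ − 4ω₀₀₁₁) > 0` for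
`k ≤ 2` (there `t₂ ≤ t_k < 1/5`) and `∫_{Δ₄ ∩ {4/5 < t₃}} (ω₀₀₀₁ − 4ω₀₀₁₁) < 0`. Hence
`target_not_mem_slabCalculus` (`k ≤ 2`) and `target_not_mem_slabCalculus_three`: **no variable of the
crux is a spectator — every move chain for `ζ(4) = 4ζ(3,1)` applies to EACH coordinate `t_k` a
substitution that does not preserve its slab, or integrates `t_k` out (an NL move from dimension `k+1` to
`k`); no proof works fibrewise over a frozen `t_k`, even with Stokes moves in the other variables.**

Sources: M. Kontsevich, D. Zagier, *Periods* (2001), §1.2 rules (1)–(3).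
-/

noncomputable section

namespace Summit.KontsevichZagierPeriods.GpcZeta4Eq4zeta31.Negative

open Set MeasureTheory
open Literature.NumberTheory.Transcendental
open Literature.NumberTheory.Transcendental.KZ
open Summit.KontsevichZagierPeriods.MzvKernelInKZ.Negative
open Summit.KontsevichZagierPeriods.HoffmanRelationInKZ.Negative
  (windowEval windowEval_of addOnly addOnly_le_ker_windowEval setIntegral_pos_of_pos_on)

/-! ## No spectator variable: slab invariants compatible with Newton–Leibniz -/

section Slab

variable {n : ℕ}

/-- The SLAB on coordinate `k`: `{x | x_k ∈ S}` (empty in dimensions `≤ k`). -/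
def slab (k : ℕ) (S : Set ℝ) (n : ℕ) : Set (Fin n → ℝ) := {x | ∃ h : k < n, x ⟨k, h⟩ ∈ S}

/-- In dimension `> k` the slab is a coordinate preimage. [folklore] -/
theorem slab_eq_of_lt (k : ℕ) (S : Set ℝ) {n : ℕ} (h : k < n) : slab k S n = {x | x ⟨k, h⟩ ∈ S} := by
  ext x
  simp only [slab, mem_setOf_eq]
  exact ⟨fun ⟨_, hx⟩ => hx, fun hx => ⟨h, hx⟩⟩

/-- In dimension `≤ k` the slab is empty. [folklore] -/
theorem slab_eq_empty (k : ℕ) (S : Set ℝ) {n : ℕ} (h : n ≤ k) : slab k S n = ∅ := by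
  ext x
  simp only [slab, mem_setOf_eq, mem_empty_iff_false, iff_false, not_exists]
  intro h'; omega

/-- Slabs over measurable sets are measurable. [folklore] -/
theorem measurableSet_slab (k : ℕ) {S : Set ℝ} (hS : MeasurableSet S) (n : ℕ) : MeasurableSet (slab k S n) := by
  by_cases h : k < n
  · rw [slab_eq_of_lt k S h]; exact hS.preimage (measurable_pi_apply _)
  · rw [slab_eq_empty k S (not_lt.1 h)]; exact MeasurableSet.empty

/-- The slab `{x_k < c}` (`c` rational) is `ℚ`-semialgebraic. [folklore] -/
theorem isSemialgebraic_slab_Iio (k : ℕ) (c : ℚ) (n : ℕ) :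
    Literature.ModelTheory.ExponentialFields.IsSemialgebraic ℚ (slab k (Iio (c : ℝ)) n) := by
  by_cases h : k < n
  · rw [slab_eq_of_lt k _ h]
    have e : {x : Fin n → ℝ | x ⟨k, h⟩ ∈ Iio (c : ℝ)} = {x | MvPolynomial.aeval x
        (MvPolynomial.X ⟨k, h⟩ : MvPolynomial (Fin n) ℚ) < MvPolynomial.aeval x (MvPolynomial.C c)} := by
      ext x; simp [eq_ratCast]
    rw [e]
    exact Literature.ModelTheory.ExponentialFields.isSemialgebraic_setOf_eval_lt _ _
  · rw [slab_eq_empty k _ (not_lt.1 h)]; exact Literature.ModelTheory.ExponentialFields.isSemialgebraic_empty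

/-- The slab `{c < x_k}` (`c` rational) is `ℚ`-semialgebraic. [folklore] -/
theorem isSemialgebraic_slab_Ioi (k : ℕ) (c : ℚ) (n : ℕ) :
    Literature.ModelTheory.ExponentialFields.IsSemialgebraic ℚ (slab k (Ioi (c : ℝ)) n) := by
  by_cases h : k < n
  · rw [slab_eq_of_lt k _ h]
    have e : {x : Fin n → ℝ | x ⟨k, h⟩ ∈ Ioi (c : ℝ)} = {x | MvPolynomial.aeval x (MvPolynomial.C c) <
        MvPolynomial.aeval x (MvPolynomial.X ⟨k, h⟩ : MvPolynomial (Fin n) ℚ)} := by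
      ext x; simp [eq_ratCast]
    rw [e]
    exact Literature.ModelTheory.ExponentialFields.isSemialgebraic_setOf_eval_lt _ _
  · rw [slab_eq_empty k _ (not_lt.1 h)]; exact Literature.ModelTheory.ExponentialFields.isSemialgebraic_empty

/-- **Newton–Leibniz moves whose base has dimension `≠ k`** (all NL moves except those integrating out the
coordinate of index `k`, i.e. from dimension `k + 1` to `k`). -/
def nlRelExcept (k : ℕ) : Set FormalRep :=
  {c | ∃ (n : ℕ) (r : IntegralRep (n + 1)) (r' : IntegralRep n) (a b : (Fin n → ℝ) → ℝ)
      (F : (Fin (n + 1) → ℝ) → ℝ), n ≠ k ∧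
    IsSemialgebraicFunOn ℚ r.domain F ∧
    IsSemialgebraicFunOn ℚ r'.domain a ∧ IsSemialgebraicFunOn ℚ r'.domain b ∧
    (∀ x ∈ r'.domain, a x ≤ b x) ∧
    r.domain = {z | (Fin.init z : Fin n → ℝ) ∈ r'.domain ∧ a (Fin.init z) ≤ z (Fin.last n) ∧
      z (Fin.last n) ≤ b (Fin.init z)} ∧
    (∀ x ∈ r'.domain, ContinuousOn (fun t : ℝ => F (Fin.snoc x t)) (Icc (a x) (b x))) ∧
    (∀ x ∈ r'.domain, ∀ t ∈ Ioo (a x) (b x),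
      HasDerivAt (fun s : ℝ => F (Fin.snoc x s)) (r.integrand (Fin.snoc x t)) t) ∧
    (∀ x ∈ r'.domain, r'.integrand x = F (Fin.snoc x (b x)) - F (Fin.snoc x (a x))) ∧
    c = of r - of r'}

/-- These are Newton–Leibniz moves. [folklore] -/
theorem nlRelExcept_subset (k : ℕ) : nlRelExcept k ⊆ newtonLeibnizRel := by
  rintro c ⟨n, r, r', a, b, F, -, h1, h2, h3, h4, h5, h6, h7, h8, rfl⟩
  exact ⟨n, r, r', a, b, F, h1, h2, h3, h4, h5, h6, h7, h8, rfl⟩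

/-- **Slab evaluation is invariant under Newton–Leibniz moves whose base has dimension `> k`**: restrict
the move to the part of the band over `τ ∩ {x_k ∈ S}` (again a legal NL move, `x_k` being a base
coordinate) and apply soundness. [folklore] -/
theorem windowEval_slab_eq_zero_of_nl {k : ℕ} {S : Set ℝ}
    (hslab : ∀ n, Literature.ModelTheory.ExponentialFields.IsSemialgebraic ℚ (slab k S n))
    {c : FormalRep} (hc : c ∈ nlRelExcept k) : windowEval (slab k S) c = 0 := by
  obtain ⟨n, r, r', a, b, F, hnk, hF, ha, hb, hab, hdom, hcont, hderiv, hint, rfl⟩ := hc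
  rw [map_sub, windowEval_of, windowEval_of, sub_eq_zero]
  rcases lt_or_gt_of_ne hnk with hlt | hgt
  · -- both slabs are empty
    have e1 : slab k S (n + 1) = ∅ := slab_eq_empty k S (by omega)
    have e2 : slab k S n = ∅ := slab_eq_empty k S hlt.le
    simp [e1, e2]
  · -- restrict the move to the base `τ ∩ slab`
    have hk1 : k < n + 1 := by omega
    let τ' : Set (Fin n → ℝ) := r'.domain ∩ slab k S n
    let B' : Set (Fin (n + 1) → ℝ) := r.domain ∩ slab k S (n + 1)
    have hτ' : Literature.ModelTheory.ExponentialFields.IsSemialgebraic ℚ τ' :=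
      r'.isSemialgebraic_domain.inter (hslab n)
    have hB' : Literature.ModelTheory.ExponentialFields.IsSemialgebraic ℚ B' :=
      r.isSemialgebraic_domain.inter (hslab (n + 1))
    let R : IntegralRep (n + 1) := r.restrict B' hB' inter_subset_left
    let R' : IntegralRep n := r'.restrict τ' hτ' inter_subset_left
    -- the slab condition on a band point is a condition on its base point
    have hslabz : ∀ z : Fin (n + 1) → ℝ, z ∈ slab k S (n + 1) ↔ (Fin.init z : Fin n → ℝ) ∈ slab k S n := by
      intro z
      rw [slab_eq_of_lt k S hk1, slab_eq_of_lt k S hgt]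
      simp only [mem_setOf_eq, Fin.init]
      have : (⟨k, hk1⟩ : Fin (n + 1)) = Fin.castSucc ⟨k, hgt⟩ := rfl
      rw [this]
    have hmem : of R - of R' ∈ newtonLeibnizRel := by
      refine ⟨n, R, R', a, b, F, hF.mono inter_subset_left hB', ha.mono inter_subset_left hτ',
        hb.mono inter_subset_left hτ', fun x hx => hab x hx.1, ?_, fun x hx => hcont x hx.1,
        fun x hx => hderiv x hx.1, fun x hx => hint x hx.1, rfl⟩
      ext z
      simp only [R, R', IntegralRep.domain_restrict, B', τ', mem_inter_iff, mem_setOf_eq]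
      rw [hslabz z, hdom]
      simp only [mem_setOf_eq]
      tauto
    have h0 : eval (of R - of R') = 0 :=
      relations_le_ker_eval_holds (newtonLeibnizRel_subset_relations hmem)
    rw [map_sub, eval_of, eval_of, sub_eq_zero] at h0
    exact h0

/-- **The slab calculus on coordinate `k`**: dissections, integrand additivity, changes of variables
PRESERVING the slab `{x_k ∈ S}`, and all Newton–Leibniz moves except those integrating out the
coordinate of index `k`. -/
def slabCalculus (k : ℕ) (S : Set ℝ) : AddSubgroup FormalRep :=
  AddSubgroup.closure (domainAddRel ∪ integrandAddRel ∪ invCovRel (slab k S) ∪ nlRelExcept k)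

/-- The slab calculus is a sub-calculus of `KZ.relations` up to semialgebraicity of the substitutions
(its NL part and additivity parts verbatim). [folklore] -/
theorem slabCalculus_moves_subset (k : ℕ) :
    domainAddRel ∪ integrandAddRel ∪ nlRelExcept k ⊆ (relations : Set FormalRep) := by
  rintro c ((hc | hc) | hc)
  · exact domainAddRel_subset_relations hc
  · exact integrandAddRel_subset_relations hc
  · exact newtonLeibnizRel_subset_relations (nlRelExcept_subset k hc)

/-- **Slab evaluation kills the slab calculus.** [folklore] -/
theorem slabCalculus_le_ker {k : ℕ} {S : Set ℝ} (hS : MeasurableSet S)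
    (hslab : ∀ n, Literature.ModelTheory.ExponentialFields.IsSemialgebraic ℚ (slab k S n)) :
    slabCalculus k S ≤ (windowEval (slab k S)).ker := by
  refine (AddSubgroup.closure_le _).mpr ?_
  rintro c ((hc | hc) | hc)
  · exact addOnly_le_ker_windowEval (measurableSet_slab k hS) (AddSubgroup.subset_closure hc)
  · exact (AddMonoidHom.mem_ker).2 (windowEval_eq_zero_of_mem_invCovRel (measurableSet_slab k hS) hc)
  · exact (AddMonoidHom.mem_ker).2 (windowEval_slab_eq_zero_of_nl hslab hc)

/-- Slab evaluation of the target is the gap integrated over `Δ₄ ∩ slab`. [folklore] -/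
theorem windowEval_slab_target (k : ℕ) (S : Set ℝ) :
    windowEval (slab k S) cFds4 = ∫ x in simplex 4 ∩ slab k S 4, hgap x := by
  rw [cFds4_eq, map_sub, windowEval_of, windowEval_of, wordRep_domain, wordRep_domain, wordRep_integrand,
    wordRep_integrand]
  have i4 : IntegrableOn (wordFun ω4 1) (simplex 4 ∩ slab k S 4) volume :=
    (integrableOn_wordFun adm_ω4 1).mono_set inter_subset_left
  have i31 : IntegrableOn (wordFun ω31 4) (simplex 4 ∩ slab k S 4) volume :=
    (integrableOn_wordFun adm_ω31 4).mono_set inter_subset_left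
  rw [← integral_sub i4 i31]
  rfl

/-- `Δ₄ ∩ {x_k < c}` is open. [folklore] -/
theorem isOpen_simplex_inter_slab_Iio {k : ℕ} (hk : k < 4) (c : ℝ) :
    IsOpen (simplex 4 ∩ slab k (Iio c) 4) := by
  rw [slab_eq_of_lt k _ hk]
  exact (KZ.isOpen_openOrderedSimplex 4).inter ((isOpen_Iio).preimage (continuous_apply _))

/-- `Δ₄ ∩ {c < x_k}` is open. [folklore] -/
theorem isOpen_simplex_inter_slab_Ioi {k : ℕ} (hk : k < 4) (c : ℝ) :
    IsOpen (simplex 4 ∩ slab k (Ioi c) 4) := by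
  rw [slab_eq_of_lt k _ hk]
  exact (KZ.isOpen_openOrderedSimplex 4).inter ((isOpen_Ioi).preimage (continuous_apply _))

/-- The point `(1/10, 1/20, 1/30, 1/40)` of `Δ₄`. -/
def lowPoint : Fin 4 → ℝ := fun i => (([1/10, 1/20, 1/30, 1/40] : List ℚ).getD i 0 : ℚ)

/-- The point `(39/40, 29/30, 19/20, 9/10)` of `Δ₄`. -/
def highPoint : Fin 4 → ℝ := fun i => (([39/40, 29/30, 19/20, 9/10] : List ℚ).getD i 0 : ℚ)

/-- `lowPoint ∈ Δ₄` with all coordinates `< 1/5`. [folklore] -/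
theorem lowPoint_mem {k : ℕ} (hk : k < 4) : lowPoint ∈ simplex 4 ∩ slab k (Iio ((1/5 : ℚ) : ℝ)) 4 := by
  rw [slab_eq_of_lt k _ hk]
  refine ⟨⟨fun i => ?_, fun i => ?_, ?_⟩, ?_⟩
  · fin_cases i <;> norm_num [lowPoint]
  · fin_cases i <;> norm_num [lowPoint]
  · refine Fin.strictAnti_iff_succ_lt.2 fun i => ?_
    fin_cases i <;> norm_num [lowPoint]
  · simp only [mem_setOf_eq, mem_Iio, lowPoint]
    interval_cases k <;> norm_num

/-- `highPoint ∈ Δ₄` with all coordinates `> 4/5`. [folklore] -/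
theorem highPoint_mem {k : ℕ} (hk : k < 4) : highPoint ∈ simplex 4 ∩ slab k (Ioi ((4/5 : ℚ) : ℝ)) 4 := by
  rw [slab_eq_of_lt k _ hk]
  refine ⟨⟨fun i => ?_, fun i => ?_, ?_⟩, ?_⟩
  · fin_cases i <;> norm_num [highPoint]
  · fin_cases i <;> norm_num [highPoint]
  · refine Fin.strictAnti_iff_succ_lt.2 fun i => ?_
    fin_cases i <;> norm_num [highPoint]
  · simp only [mem_setOf_eq, mem_Ioi, highPoint]
    interval_cases k <;> norm_num

/-- **The gap is positive on `Δ₄ ∩ {x_k < 1/5}` for `k ≤ 2`** (then `x₂ ≤ x_k < 1/5`). [folklore] -/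
theorem hgap_pos_of_slab_Iio {k : ℕ} (hk4 : k < 4) (hk : k ≤ 2) {x : Fin 4 → ℝ}
    (hx : x ∈ simplex 4 ∩ slab k (Iio ((1/5 : ℚ) : ℝ)) 4) : 0 < hgap x := by
  rw [slab_eq_of_lt k _ hk4] at hx
  obtain ⟨⟨hpos, hlt1, hanti⟩, hk5⟩ := hx
  simp only [mem_setOf_eq, mem_Iio] at hk5
  push_cast at hk5
  have hle : x 2 ≤ x ⟨k, hk4⟩ := hanti.antitone (show (⟨k, hk4⟩ : Fin 4) ≤ 2 from hk)
  exact hgap_pos (hpos 0) (hpos 1) (hpos 2) (by linarith) (hlt1 3)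

/-- **The gap is negative on `Δ₄ ∩ {4/5 < x₃}`** (then `x₂ > 4/5`, so `1/x₂ < 4/(1−x₂)`). [folklore] -/
theorem hgap_neg_of_slab_Ioi {x : Fin 4 → ℝ} (hx : x ∈ simplex 4 ∩ slab 3 (Ioi ((4/5 : ℚ) : ℝ)) 4) :
    hgap x < 0 := by
  rw [slab_eq_of_lt 3 _ (by norm_num)] at hx
  obtain ⟨⟨hpos, hlt1, hanti⟩, hk5⟩ := hx
  simp only [mem_setOf_eq, mem_Ioi] at hk5
  push_cast at hk5
  have h32 : x 3 < x 2 := hanti (by decide : (2 : Fin 4) < 3)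
  have h3 : (4 : ℝ) / 5 < x 3 := hk5
  have hx2 : 4 / 5 < x 2 := by linarith
  rw [hgap_eq]
  have A : 0 < (x 0)⁻¹ := inv_pos.mpr (hpos 0)
  have B : 0 < (x 1)⁻¹ := inv_pos.mpr (hpos 1)
  have C : 0 < (1 - x 3)⁻¹ := inv_pos.mpr (by linarith [hlt1 3])
  have key : (x 2)⁻¹ < 4 * (1 - x 2)⁻¹ := by
    rw [← div_eq_mul_inv, ← one_div, div_lt_div_iff₀ (hpos 2) (by linarith [hlt1 2])]
    linarith
  exact mul_neg_of_pos_of_neg (mul_pos (mul_pos A B) C) (sub_neg.2 key)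

/-- **Slab evaluation of the target is positive for `k ≤ 2`.** [folklore] -/
theorem windowEval_slab_target_pos {k : ℕ} (hk : k ≤ 2) :
    0 < windowEval (slab k (Iio ((1/5 : ℚ) : ℝ))) cFds4 := by
  have hk4 : k < 4 := by omega
  rw [windowEval_slab_target]
  exact setIntegral_pos_of_pos_on (isOpen_simplex_inter_slab_Iio hk4 _) ⟨_, lowPoint_mem hk4⟩
    (fun x hx => hgap_pos_of_slab_Iio hk4 hk hx) (integrableOn_hgap.mono_set inter_subset_left)

/-- **Slab evaluation of the target is negative for `k = 3`.** [folklore] -/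
theorem windowEval_slab_target_neg : windowEval (slab 3 (Ioi ((4/5 : ℚ) : ℝ))) cFds4 < 0 := by
  rw [windowEval_slab_target]
  have h := setIntegral_pos_of_pos_on (isOpen_simplex_inter_slab_Ioi (show 3 < 4 by norm_num) _)
    ⟨_, highPoint_mem (show 3 < 4 by norm_num)⟩
    (fun x hx => neg_pos.2 (hgap_neg_of_slab_Ioi hx)) ((integrableOn_hgap.mono_set inter_subset_left).neg)
  rw [integral_neg] at h
  linarith

/-- **NO SPECTATOR VARIABLE (coordinates `k ≤ 2`).** The target is not in the slab calculus on
coordinate `k`: every move chain for `ζ(4) = 4ζ(3,1)` applies to the coordinate of index `k` a change of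
variables that does not preserve the slab `{t_k < 1/5}`, or integrates it out by a Newton–Leibniz move
from dimension `k + 1` to `k` — no proof works fibrewise over `t_k` as a frozen parameter, EVEN WITH
Stokes moves in the other variables. [folklore] -/
theorem target_not_mem_slabCalculus {k : ℕ} (hk : k ≤ 2) : cFds4 ∉ slabCalculus k (Iio ((1/5 : ℚ) : ℝ)) :=
  fun h => by
  have h0 := slabCalculus_le_ker measurableSet_Iio (isSemialgebraic_slab_Iio k (1/5)) h
  rw [AddMonoidHom.mem_ker] at h0
  exact (windowEval_slab_target_pos hk).ne' h0

/-- **NO SPECTATOR VARIABLE (`k = 3`, the smallest coordinate)**, slab `{4/5 < t₃}`. [folklore] -/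
theorem target_not_mem_slabCalculus_three : cFds4 ∉ slabCalculus 3 (Ioi ((4/5 : ℚ) : ℝ)) := fun h => by
  have h0 := slabCalculus_le_ker measurableSet_Ioi (isSemialgebraic_slab_Ioi 3 (4/5)) h
  rw [AddMonoidHom.mem_ker] at h0
  exact windowEval_slab_target_neg.ne h0

end Slab

end Summit.KontsevichZagierPeriods.GpcZeta4Eq4zeta31.Negative
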